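import Summits.NavierStokesRegularity.NavierStokesRegularity.Theorems.QuietScarPocketDoorTerminalTrace
import HarnessLib

/-!
# Door S31 `QuietScarPocketDoor`, K-piece PK1 `scarPocketZoom_holds` — brick L for STUB F4a
# `exists_topCurl_of_classZoom`: limit tools (a.e. → everywhere under equi-Hölder bounds; `L³` subsequences;
# terminal traces from a Hölder modulus in time)

Width-seat file (prover ns-imp-p1 g4 under LEAD ns-s30-p1; PK1 skeleton `PK1-Skeleton.lean` sha16
e9d92a063109a968, stub F4a).  Three generic limit lemmas consumed by the F4a assembly
(`Theorems/QuietScarPocketDoorZoomTop.lean`):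

* `exists_subseq_ae_tendsto_of_eLpNorm_three` — `L³(Q)` convergence of a sequence of fields gives a subsequence
  converging almost everywhere on `Q` (convergence in measure, Mathlib's `TendstoInMeasure.exists_seq_tendsto_ae`;
  the tree pattern `LocalIrrotationalScarDoorZoomApex.ae_le_of_L3_limit`);
* `tendsto_of_ae_tendsto_of_equiHolder` — on an open set, almost-everywhere convergence to a CONTINUOUS limit of a
  sequence that is eventually equi-Hölder upgrades to convergence at EVERY point (a.e.-sets are dense; three-ε);
* `tendstoUniformlyOn_limUnder_of_holder_time` — a field with a Hölder modulus of continuity in time on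
  `(−η, 0) × S` has a terminal trace along `𝓝[<] 0`, uniformly on `S`, and the trace is the pointwise `limUnder`
  (the §1 topology of `…QuietScarPocketDoorTerminalTrace`: `epsDelta_of_holder_time`,
  `uniformCauchySeqOn_nhdsLT_zero`, `exists_tendstoUniformlyOn_nhdsLT_zero`).

HONEST FRAMING: a by-name helper for item 0056 (`--supports … --as helper`); door S31, PK1, item 0056
`NoTypeII` and the summit are OPEN; pure analysis, nothing here is a statement about Navier–Stokes regularity.
-/

noncomputable section

set_option linter.dupNamespace false

namespace Summit.NavierStokesRegularity.NavierStokesRegularity.Theorems.QuietScarPocketDoor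

open MeasureTheory Set Function Filter Topology TopologicalSpace Metric
open scoped NNReal ENNReal Topology

/-! ## `L³` convergence ⇒ an almost-everywhere convergent subsequence -/

/-- **`L³(Q)` convergence gives an a.e. convergent subsequence on `Q`** (convergence in measure along the tail
where the fields are measurable, then Mathlib's `TendstoInMeasure.exists_seq_tendsto_ae`). -/
theorem exists_subseq_ae_tendsto_of_eLpNorm_three {α F : Type*} [MeasurableSpace α] {μ : Measure α}
    [NormedAddCommGroup F] {f : ℕ → α → F} {g : α → F}
    (hfm : ∀ᶠ k in atTop, AEStronglyMeasurable (f k) μ) (hgm : AEStronglyMeasurable g μ)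
    (hconv : Tendsto (fun k => eLpNorm (f k - g) 3 μ) atTop (𝓝 0)) :
    ∃ φ : ℕ → ℕ, StrictMono φ ∧ ∀ᵐ z ∂μ, Tendsto (fun j => f (φ j) z) atTop (𝓝 (g z)) := by
  obtain ⟨J, hJ⟩ := eventually_atTop.1 hfm
  have hconv' : Tendsto (fun k => eLpNorm (f (k + J) - g) 3 μ) atTop (𝓝 0) :=
    hconv.comp (tendsto_add_atTop_nat J)
  have hmeasJ : ∀ k, AEStronglyMeasurable (f (k + J)) μ := fun k => hJ (k + J) (Nat.le_add_left J k)
  have hTIM : TendstoInMeasure μ (fun k => f (k + J)) atTop g :=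
    tendstoInMeasure_of_tendsto_eLpNorm (by norm_num) hmeasJ hgm hconv'
  obtain ⟨ns, hns, hae⟩ := hTIM.exists_seq_tendsto_ae
  exact ⟨fun j => ns j + J, fun a b hab => by simpa using hns hab, hae⟩

/-! ## Almost-everywhere convergence ⇒ everywhere, under equi-Hölder bounds -/

/-- The Hölder majorant `C r^α` is small for small `r`. -/
theorem exists_holder_majorant_lt (C : ℝ) {α : ℝ} (hα : 0 < α) {ε : ℝ} (hε : 0 < ε) :
    ∃ δ : ℝ, 0 < δ ∧ ∀ r : ℝ, 0 ≤ r → r < δ → C * r ^ α < ε := by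
  have h0 : Tendsto (fun r : ℝ => C * r ^ α) (𝓝 0) (𝓝 0) := by
    have h1 : Tendsto (fun r : ℝ => r ^ α) (𝓝 0) (𝓝 ((0 : ℝ) ^ α)) :=
      (Real.continuous_rpow_const hα.le).tendsto 0
    rw [Real.zero_rpow hα.ne'] at h1
    simpa using h1.const_mul C
  obtain ⟨δ, hδ, hδ'⟩ := Metric.tendsto_nhds_nhds.mp h0 ε hε
  refine ⟨δ, hδ, fun r hr hrδ => ?_⟩
  have h := hδ' (x := r) (by rwa [dist_zero_right, Real.norm_of_nonneg hr])
  rw [dist_zero_right] at h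
  exact (le_abs_self _).trans_lt h

/-- **A.e. convergence to a continuous limit upgrades to everywhere convergence for an eventually
equi-Hölder sequence** on an open set of a space whose measure charges open sets: given `z` and `ε`, pick a
nearby point `z'` of the full-measure convergence set (non-empty: balls have positive measure) and split
`dist (F k z) (G z) ≤ dist (F k z) (F k z') + dist (F k z') (G z') + dist (G z') (G z)`. -/
theorem tendsto_of_ae_tendsto_of_equiHolder {Z F : Type*} [PseudoMetricSpace Z] [MeasurableSpace Z]
    [OpensMeasurableSpace Z] {μ : Measure Z} [μ.IsOpenPosMeasure] [PseudoMetricSpace F] {f : ℕ → Z → F} {g : Z → F} {O : Set Z}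
    (hO : IsOpen O) (hae : ∀ᵐ z ∂(μ.restrict O), Tendsto (fun k => f k z) atTop (𝓝 (g z)))
    (hg : ContinuousOn g O) {C α : ℝ} (hα : 0 < α)
    (hH : ∀ᶠ k in atTop, ∀ z ∈ O, ∀ z' ∈ O, dist (f k z) (f k z') ≤ C * dist z z' ^ α) :
    ∀ z ∈ O, Tendsto (fun k => f k z) atTop (𝓝 (g z)) := by
  intro z hz
  rw [Metric.tendsto_nhds]
  intro ε hε
  have hε3 : 0 < ε / 3 := by positivity
  -- `δ₁`: Hölder majorant small; `δ₂`: `G` close to `G z` and the ball inside `O`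
  obtain ⟨δ₁, hδ₁, hδ₁'⟩ := exists_holder_majorant_lt C hα hε3
  obtain ⟨δ₂, hδ₂, hδ₂'⟩ := (Metric.continuousWithinAt_iff.1 (hg z hz)) (ε / 3) hε3
  obtain ⟨δ₃, hδ₃, hδ₃O⟩ := Metric.isOpen_iff.1 hO z hz
  set δ : ℝ := min δ₁ (min δ₂ δ₃) with hδ_def
  have hδ : 0 < δ := by positivity
  have hδ1 : δ ≤ δ₁ := min_le_left _ _
  have hδ2 : δ ≤ δ₂ := (min_le_right _ _).trans (min_le_left _ _)
  have hδ3 : δ ≤ δ₃ := (min_le_right _ _).trans (min_le_right _ _)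
  have hballO : ball z δ ⊆ O := (ball_subset_ball hδ3).trans hδ₃O
  -- a point of the convergence set in `ball z δ`
  obtain ⟨z', hz'b, hz'⟩ : ∃ z' ∈ ball z δ, Tendsto (fun k => f k z') atTop (𝓝 (g z')) := by
    by_contra hcon
    push Not at hcon
    have hae' : ∀ᵐ x ∂μ, x ∈ O → Tendsto (fun k => f k x) atTop (𝓝 (g x)) :=
      (ae_restrict_iff' hO.measurableSet).1 hae
    have hnull : μ (ball z δ) = 0 := by
      refine measure_mono_null (fun x hx => ?_) (ae_iff.1 hae')
      exact fun himp => hcon x hx (himp (hballO hx))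
    exact (measure_ball_pos μ z hδ).ne' hnull
  have hz'O : z' ∈ O := hballO hz'b
  have hd : dist z z' < δ := by rw [dist_comm]; exact mem_ball.1 hz'b
  have h3 : dist (g z') (g z) < ε / 3 := hδ₂' hz'O (by rw [dist_comm] at hd; exact hd.trans_le hδ2)
  have h1 : C * dist z z' ^ α < ε / 3 := hδ₁' _ dist_nonneg (hd.trans_le hδ1)
  have h2 := (Metric.tendsto_nhds.1 hz') (ε / 3) hε3
  filter_upwards [hH, h2] with k hk hk2
  calc dist (f k z) (g z) ≤ dist (f k z) (f k z') + dist (f k z') (g z') + dist (g z') (g z) :=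
        dist_triangle4 _ _ _ _
    _ < ε / 3 + ε / 3 + ε / 3 := by
        have := hk z hz z' hz'O
        linarith
    _ = ε := by ring

/-! ## Terminal traces from a Hölder modulus in time -/

/-- **A Hölder modulus of continuity in time near `0⁻`, uniform on `S`, gives a terminal trace along `𝓝[<] 0`,
uniformly on `S`; the trace is the pointwise `limUnder`.**  (`…TerminalTrace` §1 + uniqueness of limits.) -/
theorem tendstoUniformlyOn_limUnder_of_holder_time {Y X : Type*} [NormedAddCommGroup X] [CompleteSpace X]
    {S : Set Y} {F : ℝ → Y → X} {η C α : ℝ} (hη : 0 < η) (hα : 0 < α)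
    (hH : ∀ s ∈ Ioo (-η) (0 : ℝ), ∀ t ∈ Ioo (-η) (0 : ℝ), ∀ x ∈ S,
      dist (F t x) (F s x) ≤ C * |t - s| ^ α) :
    TendstoUniformlyOn F (fun x => limUnder (𝓝[<] (0 : ℝ)) (fun s => F s x)) (𝓝[<] (0 : ℝ)) S := by
  obtain ⟨f, hf⟩ := exists_tendstoUniformlyOn_nhdsLT_zero
    (uniformCauchySeqOn_nhdsLT_zero (epsDelta_of_holder_time hη hα hH))
  refine hf.congr_right fun x hx => ?_
  exact ((hf.tendsto_at hx).limUnder_eq).symm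

/-- Pointwise form: under the hypotheses of `tendstoUniformlyOn_limUnder_of_holder_time`, at every `x ∈ S`
the time line `s ↦ F s x` tends to its `limUnder` along `𝓝[<] 0`. -/
theorem tendsto_limUnder_of_holder_time {Y X : Type*} [NormedAddCommGroup X] [CompleteSpace X]
    {S : Set Y} {F : ℝ → Y → X} {η C α : ℝ} (hη : 0 < η) (hα : 0 < α)
    (hH : ∀ s ∈ Ioo (-η) (0 : ℝ), ∀ t ∈ Ioo (-η) (0 : ℝ), ∀ x ∈ S,
      dist (F t x) (F s x) ≤ C * |t - s| ^ α) {x : Y} (hx : x ∈ S) :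
    Tendsto (fun s => F s x) (𝓝[<] (0 : ℝ)) (𝓝 (limUnder (𝓝[<] (0 : ℝ)) (fun s => F s x))) :=
  (tendstoUniformlyOn_limUnder_of_holder_time hη hα hH).tendsto_at hx

/-- `∀ᶠ s in 𝓝[<] 0` unfolded into a window `(s₀, 0)` with `−1 ≤ s₀ < 0` (the guard of `TopCurlTendsto`). -/
theorem exists_window_of_eventually_nhdsLT {P : ℝ → Prop} (h : ∀ᶠ s in 𝓝[<] (0 : ℝ), P s) :
    ∃ s₀ : ℝ, s₀ < 0 ∧ (-1 : ℝ) ≤ s₀ ∧ ∀ s ∈ Ioo s₀ 0, P s := by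
  obtain ⟨l, hl, hlP⟩ := (mem_nhdsLT_iff_exists_Ioo_subset).1 h
  refine ⟨max l (-1), max_lt hl (by norm_num), le_max_right _ _, fun s hs => hlP ⟨?_, hs.2⟩⟩
  exact (le_max_left _ _).trans_lt hs.1

end Summit.NavierStokesRegularity.NavierStokesRegularity.Theorems.QuietScarPocketDoor

end
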